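import Literature.Probability.LatticeModels.TorusTwoPointLimit
import Literature.Probability.LatticeModels.TorusFoldable
import Literature.Probability.LatticeModels.CriticalTwoPointBounds
import Literature.Probability.LatticeModels.IsingTranslationInvariance
import HarnessLib

/-!
# The face bound on `ℤ³` at `β_c` from the torus master inequality
# (crux `ExistsContinuousLimit`, stmt-CriticalPhenomena-4582, line `free-box-deficit`, registered stub `stub_faceBound`)

Given the TORUS MASTER INEQUALITY for lattice coordinate boxes — for `β ≥ 0`, `L` even,
`4M + 2 ≤ L`, a box `[l,u] ⊆ Λ_{M−1}` and `x, y ∈ [l,u]`,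
`⟨σ_x̄σ_ȳ⟩_{𝕋_L;β} ≤ ⟨σₓσ_y⟩^free_{[l,u];β} + ∑_{faces F} ⟨σ_x̄ σ_{θ_F ȳ}⟩_{𝕋_L;β}` — we pass to the
infinite-volume limit at `β = β_c(3)` along the even tori `L = 2N → ∞` and obtain the FACE BOUND
`G(y − x) − ⟨σₓσ_y⟩^free_{[l,u];β_c} ≤ ∑_F G(𝓡_F y − x)`, `G = criticalTwoPoint 3`, where
`𝓡_F y = Function.update y i (2c − y i)` (`c = u i + 1` or `l i − 1`) is the lattice reflection in
the face `F`.

Ingredients (all proved in the tree): the convergence of the periodic two-point function to the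
plus state when `m*(β) = 0` (`abs_isingTorusTwoPoint_sub_plusCorr_le_of_spontaneousMagnetization_eq_zero`,
Aizenman–Duminil-Copin 2021, Prop. 5.2), `m*(β_c) = 0` in `d = 3`
(`spontaneousMagnetization_criticalBeta_eq_zero_holds`, Aizenman–Duminil-Copin–Sidoravicius 2015),
translation invariance of the plus state (`plusCorr_shift`), and the identification of the torus
reflection through sites with the projected lattice reflection (`Torus.reflectThroughSites_intCast_proj`).
The free-box term does not depend on `L`; the seven torus terms converge; an `ε`-argument
(`le_of_forall_pos_le_add`) finishes.
-/

noncomputable section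

namespace Summit.CriticalPhenomena.Ising3DConformalLimit.ReflectionTwinExistsContinuousLimit.FreeBox

open Finset Filter
open scoped BigOperators symmDiff ENNReal Topology
open Literature.Probability.LatticeModels
open Classical

/-- Translation invariance of the critical plus state on pairs: for `x ≠ z` in `ℤ³`,
`⟨σ_{\{x,z\}}⟩⁺_{β_c} = G(z − x)` (`plusCorr_shift` with `v = x`, `A = {0, z − x}`, and
`twoPointPlus_eq_plusCorr`). [folklore] -/
theorem plusCorr_pair_eq_criticalTwoPoint_three {x z : Site 3} (hxz : x ≠ z) :
    plusCorr 3 (criticalBeta 3) 0 {x, z} = criticalTwoPoint 3 (z - x) := by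
  -- adapted from `tendsto_isingTorusTwoPoint_criticalTwoPoint` (PrecisionLaplacianInverseMCriticalKernel)
  have hβ : 0 ≤ criticalBeta 3 := criticalBeta_nonneg 3
  have hzx : z - x ≠ 0 := sub_ne_zero.2 (Ne.symm hxz)
  have hmap : (({0, z - x} : Finset (Site 3)).map (Site.shift x).toEmbedding) = {x, z} := by
    simp [Finset.map_insert]
  rw [criticalTwoPoint, twoPointPlus_eq_plusCorr _ hzx, ← hmap, plusCorr_shift 3 hβ le_rfl x _]

/-- Convergence of the critical periodic two-point function of `(ℤ/Nℤ)³` to the critical two-point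
function of `ℤ³` (`ε`–`N₀` form): for `x ≠ z`, `|⟨σ_x̄σ_z̄⟩_{𝕋_N;β_c} − G(z − x)| ≤ ε` for all
large `N` (`m*(β_c(3)) = 0`, Aizenman–Duminil-Copin–Sidoravicius 2015, and the torus/box sandwich,
Aizenman–Duminil-Copin 2021, Prop. 5.2). [folklore] -/
theorem abs_isingTorusTwoPoint_sub_criticalTwoPoint_le_three {x z : Site 3} (hxz : x ≠ z) {ε : ℝ}
    (hε : 0 < ε) :
    ∃ N₀ : ℕ, ∀ N : ℕ, N₀ ≤ N → ∀ [NeZero N],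
      |isingTorusTwoPoint 3 N (criticalBeta 3) 0 (Torus.proj N x) (Torus.proj N z) -
        criticalTwoPoint 3 (z - x)| ≤ ε := by
  have hβ : 0 ≤ criticalBeta 3 := criticalBeta_nonneg 3
  have hm : spontaneousMagnetization 3 (criticalBeta 3) = 0 :=
    spontaneousMagnetization_criticalBeta_eq_zero_holds (d := 3) (by norm_num)
  rw [← plusCorr_pair_eq_criticalTwoPoint_three hxz]
  exact abs_isingTorusTwoPoint_sub_plusCorr_le_of_spontaneousMagnetization_eq_zero hβ hm hxz hε

/-- Every lattice coordinate box `[l,u] ⊆ ℤ³` sits inside some `Λ_{M−1}`: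
there is `M : ℕ` with `−M + 1 ≤ l i` and `u i ≤ M − 1` for all `i`. [folklore] -/
theorem exists_margin_three (l u : Site 3) :
    ∃ M : ℕ, (∀ i, -(M : ℤ) + 1 ≤ l i) ∧ (∀ i, u i ≤ (M : ℤ) - 1) := by
  refine ⟨(1 - l 0).toNat + (1 - l 1).toNat + (1 - l 2).toNat +
      (u 0 + 1).toNat + (u 1 + 1).toNat + (u 2 + 1).toNat, fun i => ?_, fun i => ?_⟩
  · fin_cases i <;> push_cast <;> omega
  · fin_cases i <;> push_cast <;> omega

/-- **Stub 5 — the face bound on `ℤ³` at `β_c`**: the torus master inequality at `β = β_c(3)` along even `L → ∞`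
(`abs_isingTorusTwoPoint_sub_plusCorr_le_of_spontaneousMagnetization_eq_zero` with `m*(β_c) = 0`,
`spontaneousMagnetization_criticalBeta_eq_zero_holds`; `θ_F ȳ = \overline{𝓡_F y}`, `Torus.reflectThroughSites_intCast_proj`).
Given the master inequality `hM` on the even tori, for `x ≠ y` in the box `[l,u]`,
`G(y − x) − ⟨σₓσ_y⟩^free_{[l,u];β_c} ≤ ∑_{i} (G(𝓡⁺_i y − x) + G(𝓡⁻_i y − x))` with
`𝓡^±_i` the reflections in the faces `yᵢ = uᵢ + 1`, `yᵢ = lᵢ − 1`. [folklore] -/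
theorem stub_faceBound
    (hM : ∀ (β : ℝ), 0 ≤ β → ∀ (L : ℕ) [NeZero L], Even L → ∀ (M : ℕ), 4 * M + 2 ≤ L →
    ∀ (l u x y : Site 3), (∀ i, -(M : ℤ) + 1 ≤ l i) → (∀ i, u i ≤ (M : ℤ) - 1) →
      (∀ i, l i ≤ x i ∧ x i ≤ u i) → (∀ i, l i ≤ y i ∧ y i ≤ u i) →
    isingTorusTwoPoint 3 L β 0 (Torus.proj L x) (Torus.proj L y) ≤
      isingTwoPoint (zdGraph 3) (Fintype.piFinset fun i => Finset.Icc (l i) (u i)) β 0 .free x y +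
        ∑ i : Fin 3, (isingTorusTwoPoint 3 L β 0 (Torus.proj L x) (Torus.reflectThroughSites i (((u i + 1 : ℤ)) : ZMod L) (Torus.proj L y)) +
          isingTorusTwoPoint 3 L β 0 (Torus.proj L x) (Torus.reflectThroughSites i (((l i - 1 : ℤ)) : ZMod L) (Torus.proj L y)))) :
    ∀ (l u x y : Site 3), (∀ i, l i ≤ x i ∧ x i ≤ u i) → (∀ i, l i ≤ y i ∧ y i ≤ u i) → x ≠ y →
    criticalTwoPoint 3 (y - x) - isingTwoPoint (zdGraph 3) (Fintype.piFinset fun i => Finset.Icc (l i) (u i)) (criticalBeta 3) 0 .free x y ≤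
      ∑ i : Fin 3, (criticalTwoPoint 3 (Function.update y i (2 * (u i + 1) - y i) - x) +
        criticalTwoPoint 3 (Function.update y i (2 * (l i - 1) - y i) - x)) := by
  intro l u x y hx hy hxy
  have hβ : 0 ≤ criticalBeta 3 := criticalBeta_nonneg 3
  -- a margin `M` with `[l,u] ⊆ Λ_{M-1}`
  obtain ⟨M, hl, hu⟩ := exists_margin_three l u
  -- the reflected images of `y` lie outside the box, hence differ from `x`
  have hne₁ : ∀ i, x ≠ Function.update y i (2 * (u i + 1) - y i) := by
    intro i h
    have h1 := congrFun h i
    rw [Function.update_self] at h1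
    have := hx i
    have := hy i
    omega
  have hne₂ : ∀ i, x ≠ Function.update y i (2 * (l i - 1) - y i) := by
    intro i h
    have h1 := congrFun h i
    rw [Function.update_self] at h1
    have := hx i
    have := hy i
    omega
  -- `ε`-argument
  refine le_of_forall_pos_le_add fun ε hε => ?_
  have hε7 : 0 < ε / 7 := by positivity
  obtain ⟨N₀, hN₀⟩ := abs_isingTorusTwoPoint_sub_criticalTwoPoint_le_three hxy hε7
  choose N₁ hN₁ using fun i => abs_isingTorusTwoPoint_sub_criticalTwoPoint_le_three (hne₁ i) hε7
  choose N₂ hN₂ using fun i => abs_isingTorusTwoPoint_sub_criticalTwoPoint_le_three (hne₂ i) hε7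
  -- a large even torus `L = 2N`
  obtain ⟨N, hNN₀, hNN₁, hNN₂, hNM⟩ : ∃ N : ℕ, N₀ ≤ 2 * N ∧ (∀ i, N₁ i ≤ 2 * N) ∧ (∀ i, N₂ i ≤ 2 * N) ∧
      4 * M + 2 ≤ 2 * N := by
    refine ⟨N₀ + Finset.univ.sup N₁ + Finset.univ.sup N₂ + (4 * M + 2), by omega, fun i => ?_, fun i => ?_,
      by omega⟩
    · have := Finset.le_sup (f := N₁) (Finset.mem_univ i)
      omega
    · have := Finset.le_sup (f := N₂) (Finset.mem_univ i)
      omega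
  haveI : NeZero (2 * N) := ⟨by omega⟩
  have key := hM (criticalBeta 3) hβ (2 * N) (even_two_mul N) M hNM l u x y hl hu hx hy
  simp only [Torus.reflectThroughSites_intCast_proj] at key
  -- the seven limits
  have h0 := abs_le.1 (hN₀ (2 * N) hNN₀)
  have h1 : ∀ i, |isingTorusTwoPoint 3 (2 * N) (criticalBeta 3) 0 (Torus.proj (2 * N) x)
      (Torus.proj (2 * N) (Function.update y i (2 * (u i + 1) - y i))) -
        criticalTwoPoint 3 (Function.update y i (2 * (u i + 1) - y i) - x)| ≤ ε / 7 :=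
    fun i => hN₁ i (2 * N) (hNN₁ i)
  have h2 : ∀ i, |isingTorusTwoPoint 3 (2 * N) (criticalBeta 3) 0 (Torus.proj (2 * N) x)
      (Torus.proj (2 * N) (Function.update y i (2 * (l i - 1) - y i))) -
        criticalTwoPoint 3 (Function.update y i (2 * (l i - 1) - y i) - x)| ≤ ε / 7 :=
    fun i => hN₂ i (2 * N) (hNN₂ i)
  have h10 := abs_le.1 (h1 0)
  have h11 := abs_le.1 (h1 1)
  have h12 := abs_le.1 (h1 2)
  have h20 := abs_le.1 (h2 0)
  have h21 := abs_le.1 (h2 1)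
  have h22 := abs_le.1 (h2 2)
  simp only [Fin.sum_univ_three] at key ⊢
  linarith [h0.1, h0.2, h10.1, h10.2, h11.1, h11.2, h12.1, h12.2, h20.1, h20.2, h21.1, h21.2,
    h22.1, h22.2]

end Summit.CriticalPhenomena.Ising3DConformalLimit.ReflectionTwinExistsContinuousLimit.FreeBox

end
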